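import Mathlib

/-!
# Two-spin block: the diagonal splitting identity — at every exact crossing some classical
# parameter (h₁, h₂ or J) splits the degeneracy at first order, uniformly

[cite: ImbrieJSP2016, eq. (1.1), §4.2.1 (block Hamiltonians of resonant blocks)]

Basis order `(σ₁,σ₂) = (++), (+−), (−+), (−−)`; the classical parameter directions of the two-spin
block `H = h₁Z₁ + h₂Z₂ + JZ₁Z₂ + t₁X₁ + t₂X₂` are `Z₁ = diag(1,1,−1,−1)`, `Z₂ = diag(1,−1,1,−1)`,
`Z₁Z₂ = diag(1,−1,−1,1)`.  For a pair of vectors `f, p` (a frame of a 2-plane `V`) and a symmetric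
`A`, the first-order splitting functional is `T_A(f,p) = (fᵀAf − pᵀAp)² + 4(fᵀAp)²` = the squared
difference of the two eigenvalues of the compression of `A` to `V` (when `f ⊥ p`, `|f| = |p| = 1`).
* `twoSpin_diagonal_splitting_identity`: `T_{Z₁} + T_{Z₂} + T_{Z₁Z₂} = 4 Σ_k (f_k² + p_k²)² −
  [(|f|² − |p|²)² + 4(f·p)²]` — Parseval on the diagonal subalgebra (pure `ring`);
* `twoSpin_diagonal_splitting_lower_bound`: for an isotropic pair (`|f|² = |p|²`, `f ⊥ p`),
  `T_{Z₁} + T_{Z₂} + T_{Z₁Z₂} ≥ (Σ_k (f_k² + p_k²))²`; for an orthonormal frame the right side is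
  `(|f|² + |p|²)² = 4`, so some `A ∈ {Z₁, Z₂, Z₁Z₂}` has `T_A ≥ 4/3`: every two-dimensional
  (degenerate eigen)space of the block is split at first order, at rate ≥ `2/√3`, by one of the
  three classical parameters — uniformly over the whole parameter space.
This is the quantitative non-degeneracy input (L4′) of the corner volume lemma in the audit cell's
programme (pub-imbrie, LLA.md gen-6 N12–N13).  Audit lemmas; they neither prove nor disprove LLA.
-/

namespace Literature.MathematicalPhysics.QuantumLattice.Imbrie2016

/-- [cite: ImbrieJSP2016, eq. (1.1), §4.2.1] Parseval on the diagonal subalgebra: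
`T_{Z₁} + T_{Z₂} + T_{Z₁Z₂} = 4Σ_k (f_k²+p_k²)² − [(|f|²−|p|²)² + 4(f·p)²]`. -/
theorem twoSpin_diagonal_splitting_identity (f₁ f₂ f₃ f₄ p₁ p₂ p₃ p₄ : ℝ) :
    ((f₁ ^ 2 + f₂ ^ 2 - f₃ ^ 2 - f₄ ^ 2 - (p₁ ^ 2 + p₂ ^ 2 - p₃ ^ 2 - p₄ ^ 2)) ^ 2
        + 4 * (f₁ * p₁ + f₂ * p₂ - f₃ * p₃ - f₄ * p₄) ^ 2)
      + ((f₁ ^ 2 - f₂ ^ 2 + f₃ ^ 2 - f₄ ^ 2 - (p₁ ^ 2 - p₂ ^ 2 + p₃ ^ 2 - p₄ ^ 2)) ^ 2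
        + 4 * (f₁ * p₁ - f₂ * p₂ + f₃ * p₃ - f₄ * p₄) ^ 2)
      + ((f₁ ^ 2 - f₂ ^ 2 - f₃ ^ 2 + f₄ ^ 2 - (p₁ ^ 2 - p₂ ^ 2 - p₃ ^ 2 + p₄ ^ 2)) ^ 2
        + 4 * (f₁ * p₁ - f₂ * p₂ - f₃ * p₃ + f₄ * p₄) ^ 2)
      = 4 * ((f₁ ^ 2 + p₁ ^ 2) ^ 2 + (f₂ ^ 2 + p₂ ^ 2) ^ 2 + (f₃ ^ 2 + p₃ ^ 2) ^ 2
          + (f₄ ^ 2 + p₄ ^ 2) ^ 2)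
        - ((f₁ ^ 2 + f₂ ^ 2 + f₃ ^ 2 + f₄ ^ 2 - (p₁ ^ 2 + p₂ ^ 2 + p₃ ^ 2 + p₄ ^ 2)) ^ 2
          + 4 * (f₁ * p₁ + f₂ * p₂ + f₃ * p₃ + f₄ * p₄) ^ 2) := by
  ring

/-- [cite: ImbrieJSP2016, eq. (1.1), §4.2.1] Uniform first-order splitting by a classical
parameter: for an isotropic pair (`|f|² = |p|²`, `f ⊥ p`) the three diagonal splitting functionals
sum to at least `(Σ_k (f_k² + p_k²))²` (= 4 for an orthonormal frame). -/
theorem twoSpin_diagonal_splitting_lower_bound (f₁ f₂ f₃ f₄ p₁ p₂ p₃ p₄ : ℝ)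
    (hnorm : f₁ ^ 2 + f₂ ^ 2 + f₃ ^ 2 + f₄ ^ 2 = p₁ ^ 2 + p₂ ^ 2 + p₃ ^ 2 + p₄ ^ 2)
    (horth : f₁ * p₁ + f₂ * p₂ + f₃ * p₃ + f₄ * p₄ = 0) :
    (f₁ ^ 2 + p₁ ^ 2 + (f₂ ^ 2 + p₂ ^ 2) + (f₃ ^ 2 + p₃ ^ 2) + (f₄ ^ 2 + p₄ ^ 2)) ^ 2 ≤
    ((f₁ ^ 2 + f₂ ^ 2 - f₃ ^ 2 - f₄ ^ 2 - (p₁ ^ 2 + p₂ ^ 2 - p₃ ^ 2 - p₄ ^ 2)) ^ 2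
        + 4 * (f₁ * p₁ + f₂ * p₂ - f₃ * p₃ - f₄ * p₄) ^ 2)
      + ((f₁ ^ 2 - f₂ ^ 2 + f₃ ^ 2 - f₄ ^ 2 - (p₁ ^ 2 - p₂ ^ 2 + p₃ ^ 2 - p₄ ^ 2)) ^ 2
        + 4 * (f₁ * p₁ - f₂ * p₂ + f₃ * p₃ - f₄ * p₄) ^ 2)
      + ((f₁ ^ 2 - f₂ ^ 2 - f₃ ^ 2 + f₄ ^ 2 - (p₁ ^ 2 - p₂ ^ 2 - p₃ ^ 2 + p₄ ^ 2)) ^ 2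
        + 4 * (f₁ * p₁ - f₂ * p₂ - f₃ * p₃ + f₄ * p₄) ^ 2) := by
  rw [twoSpin_diagonal_splitting_identity]
  have h0 : (f₁ ^ 2 + f₂ ^ 2 + f₃ ^ 2 + f₄ ^ 2 - (p₁ ^ 2 + p₂ ^ 2 + p₃ ^ 2 + p₄ ^ 2)) = 0 := by
    linarith
  rw [h0, horth]
  nlinarith [sq_nonneg (f₁ ^ 2 + p₁ ^ 2 - (f₂ ^ 2 + p₂ ^ 2)),
    sq_nonneg (f₁ ^ 2 + p₁ ^ 2 - (f₃ ^ 2 + p₃ ^ 2)), sq_nonneg (f₁ ^ 2 + p₁ ^ 2 - (f₄ ^ 2 + p₄ ^ 2)),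
    sq_nonneg (f₂ ^ 2 + p₂ ^ 2 - (f₃ ^ 2 + p₃ ^ 2)), sq_nonneg (f₂ ^ 2 + p₂ ^ 2 - (f₄ ^ 2 + p₄ ^ 2)),
    sq_nonneg (f₃ ^ 2 + p₃ ^ 2 - (f₄ ^ 2 + p₄ ^ 2))]

end Literature.MathematicalPhysics.QuantumLattice.Imbrie2016
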